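import Literature.IUT.LogVolume.TameDualPair
import Literature.IUT.LogVolume.PacketDifferent
import Literature.IUT.LogVolume.TensorPacketUnramified
import HarnessLib

/-!
# Factorwise isometries fix `(R_I)^∼` iff `(R_I)^∼` is generated by its PURE TENSORS (`p` odd); the purely generated
# part is fixed for every `p`; at most one ramified slot ⟹ never moved

Classical non-archimedean linear algebra (nothing disputed; the [IUTchIV] locator records where the abc-iut cell uses it).
[IUTchIV] Prop. 1.1 p. 9 attaches to a tensor packet `V_I = ⊗_{ℚ_p, i ∈ I} k_i` of finitely many, NOT NECESSARILY EQUAL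
`p`-adic fields `k_i` the maximal `ℤ_p`-order `(R_I)^∼` (`normalizedPacket`, the integral closure of
`R_I = ⊗_{ℤ_p} 𝒪_{k_i}` = `integerPacket`).  A tuple `g = (g_i)` of factorwise `ℚ_p`-linear ISOMETRIES acts on `V_I` by
`⊗ g_i` (`PiTensorProduct.congr g`) and may MOVE `(R_I)^∼`.  The cell's R-J row Y-29b decided this in kernel for EQUAL slot
fields (`|I| ≥ 2`: mover ⟺ `k` «bad»; `DyadicPrimeResidueEmbeddingOrder`, `IsometryMoverSlotAscent`,
`TameRamificationIndex`) and, for MIXED slot fields, in the stable direction only.  This file draws the line for ARBITRARY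
slot fields through ONE lattice property of `(R_I)^∼`:

  `(PG)`  `(R_I)^∼` is additively generated by its INTEGRAL PURE TENSORS `⊗_i x_i ∈ (R_I)^∼`
          (`(R_I)^∼ ≤ AddSubgroup.closure {t ∈ (R_I)^∼ | t = ⊗ x_i}`; the reverse inclusion is trivial).

* §1 (EVERY `p`) `congr_image_normalizedPacket_eq_of_closure_pure`: `(PG) ⟹` every factorwise isometry tuple fixes
  `(R_I)^∼` — an isometry turns `x_i ≠ 0` into `u_i·x_i`, `‖u_i‖ = 1`, so `⊗ g_i x_i = (⊗ u_i)·(⊗ x_i)` with `⊗ u_i ∈ R_I`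
  (no valuations, no embeddings); `not_exists_isometry_mover_of_closure_pure`; and, contrapositively,
  `not_closure_pure_of_isometry_mover`: every landed two-slot mover CERTIFIES that its `(R_I)^∼` is not purely generated.
* §2 (`p` ODD) `mem_closure_pure_of_isometry_stable`: if `(R_I)^∼` is fixed by every factorwise isometry tuple then `(PG)`.
  Each `k_i` has an ORTHOGONAL (norm-dominated) `ℚ_p`-basis `b^{(i)}` (abc-iut-E-t42's `TameDualPair.exists_dominated_basis`,
  Weil II §1 Prop. 3); for `p ≠ 2`, `D = id + E_jj` («double the `j`-th coordinate», `E_jj x = x_j·b_j`) is an ISOMETRY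
  (`‖2‖_p = 1`, `exists_isometry_add_coordProj`), so `E_jj = D − id` maps `(R_I)^∼` into itself in any one slot, hence so
  does `⊗_i E^{(i)}_{γ_iγ_i}` (`map_mem_normalizedPacket_of_isometry_sub_id`, slot-by-slot), which isolates the `γ`-th
  coordinate of `z` in the tensor basis `⊗_i b^{(i)}` (Mathlib `Basis.piTensorProduct`; `map_coordProj_eq_repr_smul`): every
  tensor-basis component of `z ∈ (R_I)^∼` is an integral pure tensor.  Hence `isometry_stable_iff_closure_pure` and
  `exists_isometry_mover_iff_not_closure_pure`: at odd `p`, «∃ factorwise-isometry mover ⟺ ¬(PG)», slot fields arbitrary.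
* §3 (EVERY `p`) `normalizedPacket_eq_integerPacket_of_absRamificationIdx_eq_one`: if all slots but at most one (`star`)
  are absolutely UNRAMIFIED then `(R_I)^∼ = R_I` ([IUTchIV] Prop. 1.1 with `d_{I∖{star}} = 0`: campaign-S
  `purePacket_mul_mem_integerPacket` + `different_eq_top_of_absRamificationIdx_eq_one`), so `(PG)` holds and NO mover
  exists WHATEVER `k_star` is (`not_exists_isometry_mover_of_absRamificationIdx_eq_one`): the naive mixed converse «some slot
  carries a bad field ⟹ mover» is FALSE (cf. «`|I| = 1` is never moved»).

Why `p = 2` differs in §2 (remark, not a kernel claim here): the `ℤ_2`-span of the isometries of a dyadic field need not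
contain the coordinate idempotents (`‖2‖_2 < 1`); on the residual dyadic class `(R_I)^∼` is fixed although e.g. in
`ℚ_2(√−1) ⊗ ℚ_2(√−1) ≅ ℚ_2(√−1)²` the idempotent `½(1 ⊗ 1 − √−1 ⊗ √−1) ∈ (R_I)^∼` is not in the span of the integral
pure tensors (`x ⊗ y ↦ (xy, xȳ)` has `xy ≡ xȳ (mod 1+√−1)`).

Use (abc-iut cell, R-J row Y-29b, mixed-packet precision of the block-E adversary lanes): CONTAINERS only; no side taken
on [IUTchIII] Cor. 3.12.  PROOF-ONLY file (theorems, no definitions, no `Prop` facts, no `sorry`).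
[cite: Mochizuki2012, IUTchIV Prop. 1.1 p. 9] [cite: WeilBNT1967, Ch. II §1, Prop. 3] [cite: SerreLocalFields1979, Ch. III §6, Prop. 13]
-/

noncomputable section

open Module Function Set
open scoped NormedField

namespace Literature.IUT.LogVolume
namespace PureTensorCriterion

variable (p : ℕ) [hp : Fact p.Prime] {I : Type} [Fintype I] [DecidableEq I]
  (k : I → Type) [∀ i, NontriviallyNormedField (k i)] [∀ i, NormedAlgebra ℚ_[p] (k i)]

/-! ## §1 The purely generated part of `(R_I)^∼` is fixed by every factorwise isometry tuple (every `p`) -/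

omit [Fintype I] [DecidableEq I] in
/-- **Integrality of a pure tensor depends only on the slot norms**: if `⊗ x_i ∈ (R_I)^∼` and `‖y_i‖ = ‖x_i‖` for all
`i` then `⊗ y_i ∈ (R_I)^∼` — for `x_i ≠ 0`, `y = u·x` slotwise with `‖u_i‖ ≤ 1`, so `⊗ y_i = (⊗ u_i)·(⊗ x_i)` with
`⊗ u_i ∈ R_I ⊆ (R_I)^∼`; if some `x_i = 0` both tensors vanish. [cite: Mochizuki2012, IUTchIV Prop. 1.1 p. 9] -/
theorem purePacket_mem_normalizedPacket_of_norm_eq {x y : Π i, k i}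
    (hx : purePacket p k x ∈ normalizedPacket p k) (hy : ∀ i, ‖y i‖ = ‖x i‖) :
    purePacket p k y ∈ normalizedPacket p k := by
  by_cases h0 : ∃ i, x i = 0
  · obtain ⟨i, hi⟩ := h0
    have hyi : y i = 0 := norm_eq_zero.mp (by rw [hy i, hi, norm_zero])
    rw [show purePacket p k y = 0 from (PiTensorProduct.tprod ℚ_[p] (s := k)).map_coord_zero i hyi]
    exact zero_mem _
  · push Not at h0
    have hu : ∀ i, ‖y i / x i‖ ≤ 1 := fun i => by rw [norm_div, hy i, div_self (norm_ne_zero_iff.mpr (h0 i))]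
    have hyx : y = (fun i => y i / x i) * x := funext fun i => (div_mul_cancel₀ (y i) (h0 i)).symm
    rw [hyx, ← purePacket_mul]
    exact mul_mem (integerPacket_le_normalizedPacket p k (purePacket_mem_integerPacket p k hu)) hx

omit [Fintype I] [DecidableEq I] in
/-- **`(PG) ⟹` factorwise isometries map `(R_I)^∼` into itself**: if `(R_I)^∼` is additively generated by its pure
tensors then `(⊗ g_i)(z) ∈ (R_I)^∼` for every tuple of `ℚ_p`-linear isometries `g_i` and every `z ∈ (R_I)^∼` (`⊗ g_i` sends
an integral pure tensor `⊗ x_i` to the pure tensor `⊗ g_i x_i` with the same slot norms). [cite: Mochizuki2012, IUTchIV Prop. 1.1 p. 9] -/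
theorem congr_mem_normalizedPacket_of_closure_pure
    (hgen : ∀ z ∈ normalizedPacket p k, z ∈ AddSubgroup.closure
      {t : PacketAlgebra p k | t ∈ normalizedPacket p k ∧ ∃ x : Π i, k i, t = purePacket p k x})
    (g : ∀ i, k i ≃ₗ[ℚ_[p]] k i) (hg : ∀ i x, ‖g i x‖ = ‖x‖)
    {z : PacketAlgebra p k} (hz : z ∈ normalizedPacket p k) :
    (PiTensorProduct.congr g : PacketAlgebra p k ≃ₗ[ℚ_[p]] PacketAlgebra p k) z ∈ normalizedPacket p k := by
  refine AddSubgroup.closure_induction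
    (p := fun t _ => (PiTensorProduct.congr g : PacketAlgebra p k ≃ₗ[ℚ_[p]] PacketAlgebra p k) t ∈
      normalizedPacket p k) ?_ ?_ ?_ ?_ (hgen z hz)
  · rintro _ ⟨ht, x, rfl⟩
    have h : (PiTensorProduct.congr g : PacketAlgebra p k ≃ₗ[ℚ_[p]] PacketAlgebra p k) (purePacket p k x) =
        purePacket p k (fun i => g i (x i)) := PiTensorProduct.congr_tprod g x
    rw [h]
    exact purePacket_mem_normalizedPacket_of_norm_eq p k ht fun i => hg i (x i)
  · rw [map_zero]; exact zero_mem _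
  · intro a b _ _ ha hb; rw [map_add]; exact add_mem ha hb
  · intro a _ ha; rw [map_neg]; exact neg_mem ha

omit [Fintype I] [DecidableEq I] in
/-- **`(PG) ⟹ (⊗ g_i)((R_I)^∼) = (R_I)^∼`** for every tuple of factorwise `ℚ_p`-linear isometries (apply the
previous theorem to `g` and to `g⁻¹`, also a tuple of isometries) — at EVERY prime `p`, for ARBITRARY (mixed) slot
fields. [cite: Mochizuki2012, IUTchIV Prop. 1.1 p. 9] -/
theorem congr_image_normalizedPacket_eq_of_closure_pure
    (hgen : ∀ z ∈ normalizedPacket p k, z ∈ AddSubgroup.closure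
      {t : PacketAlgebra p k | t ∈ normalizedPacket p k ∧ ∃ x : Π i, k i, t = purePacket p k x})
    (g : ∀ i, k i ≃ₗ[ℚ_[p]] k i) (hg : ∀ i x, ‖g i x‖ = ‖x‖) :
    (PiTensorProduct.congr g : PacketAlgebra p k ≃ₗ[ℚ_[p]] PacketAlgebra p k) ''
        (normalizedPacket p k : Set (PacketAlgebra p k)) = normalizedPacket p k := by
  have hg' : ∀ i x, ‖(g i).symm x‖ = ‖x‖ := fun i x => by rw [← hg i ((g i).symm x), LinearEquiv.apply_symm_apply]
  have hsymm : ∀ z, (PiTensorProduct.congr fun i => (g i).symm :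
      PacketAlgebra p k ≃ₗ[ℚ_[p]] PacketAlgebra p k) z =
      (PiTensorProduct.congr g : PacketAlgebra p k ≃ₗ[ℚ_[p]] PacketAlgebra p k).symm z := fun z => rfl
  apply Subset.antisymm
  · rintro _ ⟨z, hz, rfl⟩
    exact congr_mem_normalizedPacket_of_closure_pure p k hgen g hg hz
  · intro z hz
    refine ⟨(PiTensorProduct.congr g : PacketAlgebra p k ≃ₗ[ℚ_[p]] PacketAlgebra p k).symm z, ?_,
      LinearEquiv.apply_symm_apply _ _⟩
    rw [← hsymm]
    exact congr_mem_normalizedPacket_of_closure_pure p k hgen (fun i => (g i).symm) hg' hz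

omit [Fintype I] [DecidableEq I] in
/-- … hence **`(PG) ⟹` NO factorwise-isometry mover of `(R_I)^∼`** (the mover currency of
`DyadicPrimeResidue.not_exists_isometry_mover_slots`, now with mixed slot fields). [cite: Mochizuki2012, IUTchIV Prop. 1.1 p. 9] -/
theorem not_exists_isometry_mover_of_closure_pure
    (hgen : ∀ z ∈ normalizedPacket p k, z ∈ AddSubgroup.closure
      {t : PacketAlgebra p k | t ∈ normalizedPacket p k ∧ ∃ x : Π i, k i, t = purePacket p k x}) :
    ¬ ∃ (g : ∀ i, k i ≃ₗ[ℚ_[p]] k i) (_ : ∀ i x, ‖g i x‖ = ‖x‖) (z : PacketAlgebra p k),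
        z ∈ normalizedPacket p k ∧
        (PiTensorProduct.congr g : PacketAlgebra p k ≃ₗ[ℚ_[p]] PacketAlgebra p k) z ∉ normalizedPacket p k := by
  rintro ⟨g, hg, z, hz, hmove⟩
  exact hmove (congr_mem_normalizedPacket_of_closure_pure p k hgen g hg hz)

omit [Fintype I] [DecidableEq I] in
/-- **A mover certifies `¬(PG)`** (contrapositive, every `p`): if some tuple of factorwise isometries moves some
`z ∈ (R_I)^∼` out of `(R_I)^∼`, then `(R_I)^∼` is NOT generated by its pure tensors — e.g. at the two-slot packets `K ⊗ K`
of the landed movers (`WildCubicIsometryMover`, `WildDyadicCyclotomicIsometryMover`, …). [cite: Mochizuki2012, IUTchIV Prop. 1.1 p. 9] -/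
theorem not_closure_pure_of_isometry_mover (g : ∀ i, k i ≃ₗ[ℚ_[p]] k i) (hg : ∀ i x, ‖g i x‖ = ‖x‖)
    {z : PacketAlgebra p k} (hz : z ∈ normalizedPacket p k)
    (hmove : (PiTensorProduct.congr g : PacketAlgebra p k ≃ₗ[ℚ_[p]] PacketAlgebra p k) z ∉ normalizedPacket p k) :
    ∃ w ∈ normalizedPacket p k, w ∉ AddSubgroup.closure
      {t : PacketAlgebra p k | t ∈ normalizedPacket p k ∧ ∃ x : Π i, k i, t = purePacket p k x} := by
  by_contra h
  push Not at h
  exact hmove (congr_mem_normalizedPacket_of_closure_pure p k h g hg hz)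

omit [Fintype I] [DecidableEq I] in
/-- `R_I` always lies in the additive span of the integral pure tensors (it is generated by the pure tensors of
integers). [cite: Mochizuki2012, IUTchIV Prop. 1.1 p. 9] -/
theorem integerPacket_le_closure_pure :
    (integerPacket p k).toAddSubgroup ≤
      AddSubgroup.closure {t : PacketAlgebra p k | t ∈ normalizedPacket p k ∧ ∃ x : Π i, k i, t = purePacket p k x} :=
  integerPacket_le_of_forall_purePacket_mem p k fun x hx =>
    AddSubgroup.subset_closure ⟨integerPacket_le_normalizedPacket p k (purePacket_mem_integerPacket p k hx), x, rfl⟩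

/-! ## §2 `p` odd: an isometry-stable `(R_I)^∼` is generated by its pure tensors -/

/-- `‖2‖_p = 1` for `p ≠ 2`. [cite: NeukirchANT1999, Ch. II (4.8)] -/
private theorem norm_two_eq_one (hp2 : p ≠ 2) : ‖(2 : ℚ_[p])‖ = 1 := by
  rw [show (2 : ℚ_[p]) = ((2 : ℕ) : ℚ_[p]) by norm_num, Padic.norm_natCast_eq_one_iff]
  exact (Nat.coprime_primes hp.out Nat.prime_two).mpr hp2

/-- **«Double one coordinate» is an isometry at odd `p`.**  For an ORTHOGONAL (norm-dominated) `ℚ_p`-basis `b` of an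
ultrametric normed `ℚ_p`-space `E` (`‖x_i·b_i‖ ≤ ‖x‖`) and `p ≠ 2`, the map `D = id + E_jj`, `E_jj x = x_j·b_j`, is a
`ℚ_p`-linear ISOMETRY of `E` (inverse `id − ½E_jj`; `‖Dx‖ ≤ max(‖x‖, ‖x_j b_j‖) = ‖x‖` and
`‖x_j b_j‖ = ‖2x_j·b_j‖ ≤ ‖Dx‖`). [cite: WeilBNT1967, Ch. II §1, Prop. 3] -/
theorem exists_isometry_add_coordProj {E : Type} [NormedAddCommGroup E] [NormedSpace ℚ_[p] E]
    [IsUltrametricDist E] {κ : Type} (hp2 : p ≠ 2) (b : Basis κ ℚ_[p] E)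
    (hb : ∀ (x : E) (i : κ), ‖b.repr x i • b i‖ ≤ ‖x‖) (j : κ) :
    ∃ D : E ≃ₗ[ℚ_[p]] E, (∀ x, ‖D x‖ = ‖x‖) ∧ ∀ x, D x = x + ((b.coord j).smulRight (b j)) x := by
  set P : E →ₗ[ℚ_[p]] E := (b.coord j).smulRight (b j) with hP
  have hPapply : ∀ x, P x = b.repr x j • b j := fun x => by rw [hP, LinearMap.smulRight_apply, Basis.coord_apply]
  have hPP : ∀ x, P (P x) = P x := fun x => by
    rw [hPapply (P x), hPapply x, map_smul, Basis.repr_self, Finsupp.smul_apply, Finsupp.single_eq_same,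
      smul_eq_mul, mul_one]
  have hcomp₁ : (LinearMap.id + P) ∘ₗ (LinearMap.id - (2 : ℚ_[p])⁻¹ • P) = LinearMap.id := by
    ext x
    simp only [LinearMap.comp_apply, LinearMap.sub_apply, LinearMap.add_apply, LinearMap.smul_apply,
      LinearMap.id_apply, map_sub, map_smul, hPP]
    module
  have hcomp₂ : (LinearMap.id - (2 : ℚ_[p])⁻¹ • P) ∘ₗ (LinearMap.id + P) = LinearMap.id := by
    ext x
    simp only [LinearMap.comp_apply, LinearMap.sub_apply, LinearMap.add_apply, LinearMap.smul_apply,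
      LinearMap.id_apply, map_add, hPP]
    module
  let D : E ≃ₗ[ℚ_[p]] E :=
    LinearEquiv.ofLinear (LinearMap.id + P) (LinearMap.id - (2 : ℚ_[p])⁻¹ • P) hcomp₁ hcomp₂
  have hDx : ∀ x, D x = x + b.repr x j • b j := fun x => by
    dsimp only [D]; rw [LinearEquiv.ofLinear_apply, LinearMap.add_apply, LinearMap.id_apply, hPapply]
  refine ⟨D, fun x => ?_, fun x => by rw [hDx, hPapply]⟩
  rw [hDx]
  refine le_antisymm ((IsUltrametricDist.norm_add_le_max _ _).trans (max_le le_rfl (hb x j))) ?_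
  have hrepr : b.repr (x + b.repr x j • b j) j = 2 * b.repr x j := by
    rw [map_add, map_smul, Basis.repr_self, Finsupp.add_apply, Finsupp.smul_apply, Finsupp.single_eq_same,
      smul_eq_mul, mul_one, two_mul]
  have hdom := hb (x + b.repr x j • b j) j
  rw [hrepr, mul_smul, norm_smul, norm_two_eq_one p hp2, one_mul] at hdom
  calc ‖x‖ = ‖x + b.repr x j • b j + -(b.repr x j • b j)‖ := by rw [add_neg_cancel_right]
    _ ≤ max ‖x + b.repr x j • b j‖ ‖-(b.repr x j • b j)‖ := IsUltrametricDist.norm_add_le_max _ _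
    _ ≤ ‖x + b.repr x j • b j‖ := max_le le_rfl (by rw [norm_neg]; exact hdom)

/-- **Slot operators «isometry minus identity» map `(R_I)^∼` into itself** when `(R_I)^∼` is fixed (pointwise) by every
factorwise isometry tuple: if `f_i = D_i − id`, `D_i` a `ℚ_p`-linear isometry of `k_i`, then `(⊗_i f_i)(z) ∈ (R_I)^∼` for
`z ∈ (R_I)^∼` (induction on the set of slots switched from `id` to `f_i`; switching slot `a` composes with
`⊗(f_a at a, id elsewhere) = ⊗(D_a at a, id elsewhere) − id`). [cite: Mochizuki2012, IUTchIV Prop. 1.1 p. 9] -/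
theorem map_mem_normalizedPacket_of_isometry_sub_id
    (hstab : ∀ g : (∀ i, k i ≃ₗ[ℚ_[p]] k i), (∀ i x, ‖g i x‖ = ‖x‖) →
      ∀ z ∈ normalizedPacket p k,
        (PiTensorProduct.congr g : PacketAlgebra p k ≃ₗ[ℚ_[p]] PacketAlgebra p k) z ∈ normalizedPacket p k)
    (f : ∀ i, k i →ₗ[ℚ_[p]] k i)
    (hf : ∀ i, ∃ D : k i ≃ₗ[ℚ_[p]] k i, (∀ x, ‖D x‖ = ‖x‖) ∧ ∀ x, D x = x + f i x)
    {z : PacketAlgebra p k} (hz : z ∈ normalizedPacket p k) :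
    PiTensorProduct.map f z ∈ normalizedPacket p k := by
  choose D hDn hDf using hf
  -- one slot at a time: `⊗(f_a at a, id elsewhere) z = (⊗(D_a at a, id elsewhere)) z − z ∈ (R_I)^∼`
  have hone : ∀ (a : I) (w : PacketAlgebra p k), w ∈ normalizedPacket p k →
      PiTensorProduct.map (update (fun i => (LinearMap.id : k i →ₗ[ℚ_[p]] k i)) a (f a)) w ∈
        normalizedPacket p k := by
    intro a w hw
    let g : ∀ i, k i ≃ₗ[ℚ_[p]] k i := update (fun i => LinearEquiv.refl ℚ_[p] (k i)) a (D a)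
    have hg : ∀ i x, ‖g i x‖ = ‖x‖ := fun i x => by
      by_cases hi : i = a
      · subst hi; simp only [g, update_self, hDn]
      · simp only [g, update_of_ne hi, LinearEquiv.refl_apply]
    have hgf : (fun i => (g i : k i →ₗ[ℚ_[p]] k i)) =
        update (fun i => (LinearMap.id : k i →ₗ[ℚ_[p]] k i)) a (f a + LinearMap.id) := by
      funext i
      by_cases hi : i = a
      · subst hi; simp only [g, update_self]; ext x
        rw [LinearEquiv.coe_coe, hDf, LinearMap.add_apply, LinearMap.id_apply, add_comm]
      · simp only [g, update_of_ne hi, LinearEquiv.refl_toLinearMap]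
    have hsplit : PiTensorProduct.map (update (fun i => (LinearMap.id : k i →ₗ[ℚ_[p]] k i)) a (f a)) w =
        (PiTensorProduct.congr g : PacketAlgebra p k ≃ₗ[ℚ_[p]] PacketAlgebra p k) w - w := by
      have hcongr : (PiTensorProduct.congr g : PacketAlgebra p k ≃ₗ[ℚ_[p]] PacketAlgebra p k) w =
          PiTensorProduct.map (fun i => (g i : k i →ₗ[ℚ_[p]] k i)) w := rfl
      have hid : update (fun i => (LinearMap.id : k i →ₗ[ℚ_[p]] k i)) a LinearMap.id =
          fun i => (LinearMap.id : k i →ₗ[ℚ_[p]] k i) := update_eq_self a _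
      rw [hcongr, hgf, PiTensorProduct.map_update_add, LinearMap.add_apply, hid, PiTensorProduct.map_id,
        LinearMap.id_apply, add_sub_cancel_right]
    rw [hsplit]
    exact sub_mem (hstab g hg w hw) hw
  -- induction on the set `s` of switched slots
  have hind : ∀ s : Finset I, ∀ w ∈ normalizedPacket p k,
      PiTensorProduct.map (fun i => if i ∈ s then f i else LinearMap.id) w ∈ normalizedPacket p k := by
    intro s
    induction s using Finset.induction_on with
    | empty =>
      intro w hw; simpa only [Finset.notMem_empty, if_false, PiTensorProduct.map_id, LinearMap.id_apply] using hw
    | insert a s ha ih =>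
      intro w hw
      have hcomp : (fun i => if i ∈ insert a s then f i else (LinearMap.id : k i →ₗ[ℚ_[p]] k i)) =
          fun i => (if i ∈ s then f i else (LinearMap.id : k i →ₗ[ℚ_[p]] k i)) ∘ₗ
            update (fun i => (LinearMap.id : k i →ₗ[ℚ_[p]] k i)) a (f a) i := by
        funext i
        by_cases hi : i = a
        · subst hi; rw [update_self, if_pos (Finset.mem_insert_self _ _), if_neg ha, LinearMap.id_comp]
        · rw [update_of_ne hi, LinearMap.comp_id]; simp only [Finset.mem_insert, hi, false_or]
      rw [hcomp, PiTensorProduct.map_comp, LinearMap.comp_apply]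
      exact ih _ (hone a w hw)
  simpa only [Finset.mem_univ, if_true] using hind Finset.univ z hz

omit [DecidableEq I] in
/-- **The coordinate-projection slot operators isolate a tensor-basis coefficient**: for `ℚ_p`-bases `b^{(i)}` of the
`k_i` and a multi-index `γ`, `(⊗_i E^{(i)}_{γ_i γ_i})(z) = z_γ · ⊗_i b^{(i)}_{γ_i}`, where `z_γ` is the coordinate of
`z` at `γ` in the tensor basis `⊗_i b^{(i)}` (Mathlib `Basis.piTensorProduct`). [cite: Mochizuki2012, IUTchIV Prop. 1.1 p. 9] -/
theorem map_coordProj_eq_repr_smul {κ : I → Type} [∀ i, DecidableEq (κ i)]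
    (b : ∀ i, Basis (κ i) ℚ_[p] (k i)) (γ : ∀ i, κ i) (z : PacketAlgebra p k) :
    PiTensorProduct.map (fun i => ((b i).coord (γ i)).smulRight (b i (γ i))) z =
      (Basis.piTensorProduct b).repr z γ • purePacket p k (fun i => b i (γ i)) := by
  classical
  set B := Basis.piTensorProduct b with hB
  have hBγ : B γ = purePacket p k (fun i => b i (γ i)) := by rw [hB, Basis.piTensorProduct_apply]; rfl
  suffices h : PiTensorProduct.map (fun i => ((b i).coord (γ i)).smulRight (b i (γ i))) =
      (B.coord γ).smulRight (B γ) by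
    rw [h, LinearMap.smulRight_apply, Basis.coord_apply, hBγ]
  refine B.ext fun δ => ?_
  have hslot : (fun i => ((b i).coord (γ i)).smulRight (b i (γ i)) (b i (δ i))) =
      fun i => (if δ i = γ i then (1 : ℚ_[p]) else 0) • b i (γ i) := by
    funext i; rw [LinearMap.smulRight_apply, Basis.coord_apply, Basis.repr_self, Finsupp.single_apply]
  have hL : PiTensorProduct.map (fun i => ((b i).coord (γ i)).smulRight (b i (γ i))) (B δ) =
      (if δ = γ then (1 : ℚ_[p]) else 0) • B γ := by
    rw [hB, Basis.piTensorProduct_apply, Basis.piTensorProduct_apply, PiTensorProduct.map_tprod, hslot,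
      MultilinearMap.map_smul_univ, Fintype.prod_boole]
    by_cases hδ : δ = γ
    · rw [if_pos hδ, if_pos fun i => congrFun hδ i]
    · rw [if_neg hδ, if_neg fun h => hδ (funext h)]
  have hR : ((B.coord γ).smulRight (B γ)) (B δ) = (if δ = γ then (1 : ℚ_[p]) else 0) • B γ := by
    rw [LinearMap.smulRight_apply, Basis.coord_apply, Basis.repr_self, Finsupp.single_apply]
  rw [hL, hR]

/-- **`p` odd: if `(R_I)^∼` is fixed (pointwise) by every factorwise `ℚ_p`-linear isometry tuple, then `(R_I)^∼` is
generated by its pure tensors.**  With orthogonal bases `b^{(i)}` of the slots (`TameDualPair.exists_dominated_basis`), the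
tensor-basis component `z_γ·⊗_i b^{(i)}_{γ_i}` of `z ∈ (R_I)^∼` is `(⊗_i E^{(i)}_{γ_iγ_i})(z) ∈ (R_I)^∼` (each
`E^{(i)}_{jj} = D − id`, `D` the isometry «double the `j`-th coordinate», `‖2‖_p = 1`), a pure tensor; `z` is their sum.
[cite: Mochizuki2012, IUTchIV Prop. 1.1 p. 9] [cite: WeilBNT1967, Ch. II §1, Prop. 3] -/
theorem mem_closure_pure_of_isometry_stable [Nonempty I] [∀ i, IsUltrametricDist (k i)] [∀ i, ProperSpace (k i)]
    (hp2 : p ≠ 2)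
    (hstab : ∀ g : (∀ i, k i ≃ₗ[ℚ_[p]] k i), (∀ i x, ‖g i x‖ = ‖x‖) →
      ∀ z ∈ normalizedPacket p k,
        (PiTensorProduct.congr g : PacketAlgebra p k ≃ₗ[ℚ_[p]] PacketAlgebra p k) z ∈ normalizedPacket p k)
    {z : PacketAlgebra p k} (hz : z ∈ normalizedPacket p k) :
    z ∈ AddSubgroup.closure
      {t : PacketAlgebra p k | t ∈ normalizedPacket p k ∧ ∃ x : Π i, k i, t = purePacket p k x} := by
  have hbas : ∀ i, ∃ b : Basis (Fin (finrank ℚ_[p] (k i))) ℚ_[p] (k i),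
      ∀ (x : k i) (j : Fin (finrank ℚ_[p] (k i))), ‖b.repr x j • b j‖ ≤ ‖x‖ := fun i => by
    haveI := finiteDimensional p (k i)
    exact TameDualPair.exists_dominated_basis
  choose b hb using hbas
  obtain ⟨i₀⟩ := ‹Nonempty I›
  set B := Basis.piTensorProduct b with hB
  rw [← B.sum_repr z]
  refine AddSubgroup.sum_mem _ fun γ _ => AddSubgroup.subset_closure ⟨?_, ?_⟩
  · have hcomp : B.repr z γ • B γ = PiTensorProduct.map (fun i => ((b i).coord (γ i)).smulRight (b i (γ i))) z := by
      rw [map_coordProj_eq_repr_smul, hB, Basis.piTensorProduct_apply]; rfl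
    rw [hcomp]
    exact map_mem_normalizedPacket_of_isometry_sub_id p k hstab _
      (fun i => exists_isometry_add_coordProj p hp2 (b i) (hb i) (γ i)) hz
  · refine ⟨update (fun i => b i (γ i)) i₀ (B.repr z γ • b i₀ (γ i₀)), ?_⟩
    rw [hB, Basis.piTensorProduct_apply]; exact smul_purePacket p k i₀ _ _

/-- **`p` odd — THE DIVIDING LINE.**  `(R_I)^∼` is fixed by every tuple of factorwise `ℚ_p`-linear isometries
**iff** `(R_I)^∼` is generated by its integral pure tensors (`(PG)`), for ARBITRARY finite families of `p`-adic slot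
fields `k_i`. [cite: Mochizuki2012, IUTchIV Prop. 1.1 p. 9] [cite: WeilBNT1967, Ch. II §1, Prop. 3] -/
theorem isometry_stable_iff_closure_pure [Nonempty I] [∀ i, IsUltrametricDist (k i)] [∀ i, ProperSpace (k i)]
    (hp2 : p ≠ 2) :
    (∀ g : (∀ i, k i ≃ₗ[ℚ_[p]] k i), (∀ i x, ‖g i x‖ = ‖x‖) →
      (PiTensorProduct.congr g : PacketAlgebra p k ≃ₗ[ℚ_[p]] PacketAlgebra p k) ''
          (normalizedPacket p k : Set (PacketAlgebra p k)) = normalizedPacket p k) ↔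
    ∀ z ∈ normalizedPacket p k, z ∈ AddSubgroup.closure
      {t : PacketAlgebra p k | t ∈ normalizedPacket p k ∧ ∃ x : Π i, k i, t = purePacket p k x} := by
  refine ⟨fun h z hz => mem_closure_pure_of_isometry_stable p k hp2 (fun g hg w hw => ?_) hz,
    fun h g hg => congr_image_normalizedPacket_eq_of_closure_pure p k h g hg⟩
  have hmem : (PiTensorProduct.congr g : PacketAlgebra p k ≃ₗ[ℚ_[p]] PacketAlgebra p k) w ∈
      (PiTensorProduct.congr g : PacketAlgebra p k ≃ₗ[ℚ_[p]] PacketAlgebra p k) ''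
        (normalizedPacket p k : Set (PacketAlgebra p k)) := mem_image_of_mem _ hw
  rwa [h g hg] at hmem

/-- **`p` odd — mover form.**  Some tuple of factorwise `ℚ_p`-linear isometries moves some element of `(R_I)^∼` out of
`(R_I)^∼` **iff** some element of `(R_I)^∼` lies outside the additive span of the integral pure tensors — the exact
mixed-packet converse of the cell's Y-29b slot word. [cite: Mochizuki2012, IUTchIV Prop. 1.1 p. 9] [cite: WeilBNT1967, Ch. II §1, Prop. 3] -/
theorem exists_isometry_mover_iff_not_closure_pure [Nonempty I] [∀ i, IsUltrametricDist (k i)]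
    [∀ i, ProperSpace (k i)] (hp2 : p ≠ 2) :
    (∃ (g : ∀ i, k i ≃ₗ[ℚ_[p]] k i) (_ : ∀ i x, ‖g i x‖ = ‖x‖) (z : PacketAlgebra p k),
        z ∈ normalizedPacket p k ∧
        (PiTensorProduct.congr g : PacketAlgebra p k ≃ₗ[ℚ_[p]] PacketAlgebra p k) z ∉ normalizedPacket p k) ↔
    ∃ w ∈ normalizedPacket p k, w ∉ AddSubgroup.closure
      {t : PacketAlgebra p k | t ∈ normalizedPacket p k ∧ ∃ x : Π i, k i, t = purePacket p k x} := by
  refine ⟨fun ⟨g, hg, z, hz, hmove⟩ => not_closure_pure_of_isometry_mover p k g hg hz hmove, fun ⟨w, hw, hnot⟩ => ?_⟩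
  by_contra hno
  push Not at hno
  exact hnot (mem_closure_pure_of_isometry_stable p k hp2 hno hw)

/-! ## §3 Every `p`: at most one ramified slot ⟹ `(R_I)^∼ = R_I` ⟹ no mover, whatever the remaining slot is -/

/-- **At most one ramified slot ⟹ `(R_I)^∼ = R_I`.**  If every slot `i ≠ star` is absolutely UNRAMIFIED
(`e(k_i/ℚ_p) = 1`, so its different is `(1)`), then [IUTchIV] Prop. 1.1 `p^{d_{I∖{star}}}·(R_I)^∼ ⊆ R_I` reads
`(R_I)^∼ ⊆ R_I` (campaign-S `purePacket_mul_mem_integerPacket` with all `δ_i = 1`); `k_star` is arbitrary.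
[cite: Mochizuki2012, IUTchIV Prop. 1.1 p. 9] [cite: SerreLocalFields1979, Ch. III §6, Prop. 13] -/
theorem normalizedPacket_eq_integerPacket_of_absRamificationIdx_eq_one [∀ i, IsUltrametricDist (k i)]
    [∀ i, ProperSpace (k i)] (star : I) (he : ∀ i, i ≠ star → absRamificationIdx p (k i) = 1) :
    normalizedPacket p k = integerPacket p k := by
  refine le_antisymm (fun x hx => ?_) (integerPacket_le_normalizedPacket p k)
  have hδ : ∀ i, i ≠ star → different p (k i) = Ideal.span {(1 : Valued.integer (k i))} := fun i hi => by
    rw [Ideal.span_singleton_one]; exact different_eq_top_of_absRamificationIdx_eq_one p (k i) (he i hi)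
  have h := purePacket_mul_mem_integerPacket p k star (fun _ => 1) hδ rfl hx
  have h1 : (fun i => ((1 : Valued.integer (k i)) : k i)) = 1 := funext fun i => OneMemClass.coe_one _
  rwa [h1, purePacket_one, one_mul] at h

/-- **At most one ramified slot ⟹ every factorwise isometry tuple fixes `(R_I)^∼`, at EVERY `p`, WHATEVER the
field in the remaining slot** (bad or not): `(R_I)^∼ = R_I` is generated by the pure tensors of integers.  So the
naive mixed converse «some slot carries a bad field ⟹ a mover exists» is false; cf. «`|I| = 1` is never moved».
[cite: Mochizuki2012, IUTchIV Prop. 1.1 p. 9] [cite: SerreLocalFields1979, Ch. III §6, Prop. 13] -/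
theorem congr_image_normalizedPacket_eq_of_absRamificationIdx_eq_one [∀ i, IsUltrametricDist (k i)]
    [∀ i, ProperSpace (k i)] (star : I) (he : ∀ i, i ≠ star → absRamificationIdx p (k i) = 1)
    (g : ∀ i, k i ≃ₗ[ℚ_[p]] k i) (hg : ∀ i x, ‖g i x‖ = ‖x‖) :
    (PiTensorProduct.congr g : PacketAlgebra p k ≃ₗ[ℚ_[p]] PacketAlgebra p k) ''
        (normalizedPacket p k : Set (PacketAlgebra p k)) = normalizedPacket p k := by
  refine congr_image_normalizedPacket_eq_of_closure_pure p k (fun z hz => ?_) g hg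
  rw [normalizedPacket_eq_integerPacket_of_absRamificationIdx_eq_one p k star he] at hz
  exact integerPacket_le_closure_pure p k hz

/-- … hence **no factorwise-isometry mover** in a packet with at most one ramified slot (every `p`).
[cite: Mochizuki2012, IUTchIV Prop. 1.1 p. 9] [cite: SerreLocalFields1979, Ch. III §6, Prop. 13] -/
theorem not_exists_isometry_mover_of_absRamificationIdx_eq_one [∀ i, IsUltrametricDist (k i)]
    [∀ i, ProperSpace (k i)] (star : I) (he : ∀ i, i ≠ star → absRamificationIdx p (k i) = 1) :
    ¬ ∃ (g : ∀ i, k i ≃ₗ[ℚ_[p]] k i) (_ : ∀ i x, ‖g i x‖ = ‖x‖) (z : PacketAlgebra p k),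
        z ∈ normalizedPacket p k ∧
        (PiTensorProduct.congr g : PacketAlgebra p k ≃ₗ[ℚ_[p]] PacketAlgebra p k) z ∉ normalizedPacket p k := by
  refine not_exists_isometry_mover_of_closure_pure p k fun z hz => ?_
  rw [normalizedPacket_eq_integerPacket_of_absRamificationIdx_eq_one p k star he] at hz
  exact integerPacket_le_closure_pure p k hz

end PureTensorCriterion
end Literature.IUT.LogVolume

end
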